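/-
Copyright (c) 2026 the pub-hodgecm-mathlib formalisation cell (harness21).  Prover seat hodgecm-mathlib-K2E1-p14 (g0), Track B «K2-LIT» ENGINE E1, h413 =
`stmt-HodgeConjecture-24833`, route `HCCMUnconditional`, campaign «5Res» (b) — the PAYER of the letters `hq`∕`hqφ` of ★ X2_χ (A) at CM, dealer K2E1-plan (g7) 12:32Z «(ℓ2) … +
its instantiation «=»».
-/
import Summits.HodgeConjecture.HodgeConjecture.Theorems.K2E1LinearIndependentEvalMatrix        -- ★ (this seat): `exists_coords_differentiableOn`
import Summits.HodgeConjecture.HodgeConjecture.Theorems.K2E1ChiEisensteinSolvesXSystemU2        -- ★ row 11: `intertwinedCoeff_mem_chiSectionSpace`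
import Summits.HodgeConjecture.HodgeConjecture.Theorems.K2E1IntertwinedCoeffContinuousCMTwo     -- ★ `integrable_borelHeight_weylLongU_mul_rpow_cm_two` (Godement, `1 < σ`)
import Summits.HodgeConjecture.HodgeConjecture.Theorems.K2E1UnipotentHaarNormalisationU2        -- ★ `isInvInvariant_of_isHaarMeasure_two`
import Summits.HodgeConjecture.HodgeConjecture.Theorems.K2E1PowerMomentHolomorphy               -- ★ `re_mem_Icc_of_mem_ball`; brings ★ `differentiableOn_integral_of_dominated`, `rpow_le_rpow_add_rpow_of_le_of_le`
import Literature.NumberTheory.Automorphic.AdicCompletionCompact                                -- ★ `locallyCompactSpace_adeleRing'`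
import HarnessLib

/-!
# h413 ∕ Track B «K2-LIT», 5Res (b) — `K2E1ChiScatteringCoordsHolomorphicCMTwo`: THE SCATTERING COORDINATES `q_j(z)` OF `(ν𝓕)⁻¹·M(z)φ` IN A BASIS OF `V(χʷ, K′, ω)` ARE HOLOMORPHIC ON
# `{1 < Re}` — the payer of the letters `hq`∕`hqφ` of ★ `chiEisenstein_meromorphic_exports_cm_two_of_letters` (X2_χ (A) at the CM pair)

Cell `pub/hodgecm-mathlib`, crux H413 = `stmt-HodgeConjecture-24833`; dealer K2E1-plan (g7) (12:32Z).  THEOREMS ONLY (no `def`, no `instance`, no `notation`, no named-fact hypothesis,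
no `sorry`); lane `--kind proof --supports stmt-HodgeConjecture-24833 --as helper` (count-neutral).

THE MATHEMATICS [MoeglinWaldspurger1995, II.1.6–II.1.7; BernsteinLapid2019, §4 p. 10, §7].  §1 (generic measure space): `z ↦ ∫ c(x)·w(x)^z dm` is holomorphic on `{a < Re}` for
bounded measurable complex `c`, measurable `w > 0` with `∫ w^σ < ∞` (`σ > a`) — dominated holomorphy (★ `differentiableOn_integral_of_dominated`, two-sided majorant `w^{σ₀−R} + w^{σ₀+R}`).
§2 (CM pair): for a continuous bounded `φ` the intertwining integral `z ↦ ∫_{N(𝔸)} f_z^φ(w₀ v g) dν(v)` is holomorphic on `{1 < Re}` (Godement integrability ★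
`integrable_borelHeight_weylLongU_mul_rpow_cm_two`), hence so is `z ↦ φ̃_z(g) = (∫ …)·H(g)^{z−1}` for every `g`; by ★ `exists_coords_differentiableOn` (evaluation matrix ∘ Cramer)
the coordinates of `(ν𝓕)⁻¹·φ̃_z` in any linearly independent finite family spanning a space containing the `φ̃_z` are holomorphic on `{1 < Re}` — HEAD `exists_scatteringCoords_cm_two`
(span hypothesis `hsp`) and COROLLARY `exists_scatteringCoords_of_basis_cm_two` (a basis `bV` of `V(χʷ, K′, ω)`, `K′ ≤ K_U`, `φ ∈ V(χ, K′, ω)`: `hsp` by ★ `intertwinedCoeff_mem_chiSectionSpace`)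
= EXACTLY the letters `(q) (hq) (hqφ)` of ★ `chiEisenstein_meromorphic_exports_cm_two_of_letters` with `φ' j := (bV j : G(𝔸) → ℂ)`.
HONEST LABEL: HC_CM is proved only modulo the 7 printed citations (2 remaining named inputs: hLiu418 = `stmt-HodgeConjecture-24832`, h413 = `stmt-HodgeConjecture-24833`) until rung 0
closes; count-neutral helper, closes no socket.

## References
* [MoeglinWaldspurger1995] C. Mœglin, J.-L. Waldspurger, *Spectral Decomposition and Eisenstein Series* (1995), II.1.6–II.1.7.
* [BernsteinLapid2019] J. Bernstein, E. Lapid, *On the meromorphic continuation of Eisenstein series*, J. Amer. Math. Soc. 37 (2024) (arXiv:1911.02342), §4 p. 10, §7.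
* [Titchmarsh1939] E. C. Titchmarsh, *The Theory of Functions*, 2nd ed. (1939), §2.8 (holomorphy of dominated parameter integrals).
-/

set_option autoImplicit false
-- the mandated namespace repeats `HodgeConjecture.HodgeConjecture`, as in every `Theorems/*.lean` of this sub-problem
set_option linter.dupNamespace false

noncomputable section

open MeasureTheory Measure Filter Topology Set NumberField Metric
open scoped NNReal ENNReal
open Literature.NumberTheory Literature.NumberTheory.Automorphic Literature.NumberTheory.Automorphic.UnitaryGroup AdelicGroupData
open Literature.NumberTheory.GaloisRepresentations (HeckeCharacter)
open Summit.HodgeConjecture.HodgeConjecture.Cruxes.H413.K2E1BorelEisensteinU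
open Summit.HodgeConjecture.HodgeConjecture.Cruxes.H413.K2E1CharacterEisensteinU2Defs
open Summit.HodgeConjecture.HodgeConjecture.Cruxes.H413.K2E1ChiSectionSpaceU2Defs
open Summit.HodgeConjecture.HodgeConjecture.Cruxes.H413.K2E1LinearIndependentEvalMatrix (exists_coords_differentiableOn)
open Summit.HodgeConjecture.HodgeConjecture.Cruxes.H413.K2E1ChiEisensteinSolvesXSystemU2 (intertwinedCoeff_mem_chiSectionSpace)
open Summit.HodgeConjecture.HodgeConjecture.Cruxes.H413.K2E1IntertwinedCoeffContinuousCMTwo (integrable_borelHeight_weylLongU_mul_rpow_cm_two)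
open Summit.HodgeConjecture.HodgeConjecture.Cruxes.H413.K2E1UnipotentHaarNormalisationU2 (isInvInvariant_of_isHaarMeasure_two)
open Summit.HodgeConjecture.HodgeConjecture.Cruxes.H413.K2E1PowerMomentHolomorphy (re_mem_Icc_of_mem_ball)

namespace Summit.HodgeConjecture.HodgeConjecture.Cruxes.H413.K2E1ChiScatteringCoordsHolomorphicCMTwo

/-! ## §1 Holomorphy of `z ↦ ∫ c·w^z` for bounded complex `c` (generic measure space) -/

/-- **`z ↦ ∫ c(x)·w(x)^z dm` IS HOLOMORPHIC ON `{a < Re}`** for bounded measurable `c : X → ℂ`, measurable `w > 0` with `∫ w^σ dm < ∞` for every `σ > a` (majorant near `z₀`: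
`max M 0 · (w^{Re z₀−R} + w^{Re z₀+R})`). [cite: Titchmarsh1939, §2.8] -/
theorem differentiableOn_integral_mul_ofReal_cpow {X : Type*} [MeasurableSpace X] {m : Measure X} {w : X → ℝ} {cf : X → ℂ} (hcf : Measurable cf) (hw : Measurable w)
    (hw0 : ∀ x, 0 < w x) {M : ℝ} (hM : ∀ x, ‖cf x‖ ≤ M) {a : ℝ} (hint : ∀ σ : ℝ, a < σ → Integrable (fun x => w x ^ σ) m) :
    DifferentiableOn ℂ (fun z => ∫ x, cf x * ((w x : ℝ) : ℂ) ^ z ∂m) {z : ℂ | a < z.re} := by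
  refine Literature.Analysis.Complex.differentiableOn_integral_of_dominated (fun z _ => (hcf.mul (hw.complex_ofReal.pow_const z)).aestronglyMeasurable)
    (Eventually.of_forall fun x z _ => ?_) ?_
  · exact ((differentiableAt_id.const_cpow (Or.inl (Complex.ofReal_ne_zero.mpr (hw0 x).ne'))).const_mul _).differentiableWithinAt
  · intro z₀ hz₀
    have hz₀' : a < z₀.re := hz₀
    obtain ⟨R, hR⟩ : ∃ R : ℝ, R = (z₀.re - a) / 2 := ⟨_, rfl⟩
    have hRpos : 0 < R := by rw [hR]; linarith
    refine ⟨R, hRpos, fun z hz => ?_, fun x => max M 0 * (w x ^ (z₀.re - R) + w x ^ (z₀.re + R)),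
      ((hint _ (by rw [hR]; linarith)).add (hint _ (by rw [hR]; linarith))).const_mul _, Eventually.of_forall fun x z hz => ?_⟩
    · show a < z.re
      have h1 := (re_mem_Icc_of_mem_ball hz).1
      rw [hR] at h1
      linarith
    · rw [norm_mul, Complex.norm_cpow_eq_rpow_re_of_pos (hw0 x)]
      exact mul_le_mul ((hM x).trans (le_max_left _ _)) (Literature.NumberTheory.Automorphic.rpow_le_rpow_add_rpow_of_le_of_le (hw0 x) (re_mem_Icc_of_mem_ball hz).1 (re_mem_Icc_of_mem_ball hz).2)
        (Real.rpow_nonneg (hw0 x).le _) (le_max_right _ _)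

/-! ## §2 The CM pair: the intertwining integral, the intertwined coefficient, the scattering coordinates -/

section CM

variable (L : Type) [Field L] [NumberField L] [IsCMField L]
  [MeasurableSpace (quasiSplit (↥(maximalRealSubfield L)) L (IsCMField.complexConj L) 2).Adelic] [BorelSpace (quasiSplit (↥(maximalRealSubfield L)) L (IsCMField.complexConj L) 2).Adelic]

/-- **THE INTERTWINING INTEGRAL `z ↦ ∫_{N(𝔸)} f_z^φ(w₀ v g) dν` IS HOLOMORPHIC ON `{1 < Re}`** for continuous bounded `φ` (`f_z^φ(x) = φ(x)·H(x)^z`, §1 with Godement's ★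
`integrable_borelHeight_weylLongU_mul_rpow_cm_two`). [cite: MoeglinWaldspurger1995, II.1.6–II.1.7] -/
theorem differentiableOn_intertwiningIntegral_cm_two (ν : Measure ↥(adelicUnipotent (↥(maximalRealSubfield L)) L (IsCMField.complexConj L) 2)) [ν.IsHaarMeasure]
    {𝓕 : Set ↥(adelicUnipotent (↥(maximalRealSubfield L)) L (IsCMField.complexConj L) 2)} (h𝓕N : IsFundamentalDomain ↥(rationalUnipotent (↥(maximalRealSubfield L)) L (IsCMField.complexConj L) 2) 𝓕 ν) (h𝓕c : IsCompact (closure 𝓕))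
    {φ : (quasiSplit (↥(maximalRealSubfield L)) L (IsCMField.complexConj L) 2).Adelic → ℂ} (hφc : Continuous φ) {Mφ : ℝ} (hφM : ∀ x, ‖φ x‖ ≤ Mφ) (g : (quasiSplit (↥(maximalRealSubfield L)) L (IsCMField.complexConj L) 2).Adelic) :
    DifferentiableOn ℂ (fun z : ℂ => ∫ v : ↥(adelicUnipotent (↥(maximalRealSubfield L)) L (IsCMField.complexConj L) 2), flatSectionU φ z ((quasiSplit (↥(maximalRealSubfield L)) L (IsCMField.complexConj L) 2).toAdelic (weylLongU ((IsCMField.complexConj L : L ≃ₐ[↥(maximalRealSubfield L)] L) : L →+* L) (rfl : (StdForm.antidiagonal 2).over L = (StdForm.antidiagonal 2).over L)) * ((v : (quasiSplit (↥(maximalRealSubfield L)) L (IsCMField.complexConj L) 2).Adelic) * g)) ∂ν) {z : ℂ | 1 < z.re} := by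
  haveI : LocallyCompactSpace (AdeleRing (𝓞 L) L) := locallyCompactSpace_adeleRing' L
  haveI := isInvInvariant_of_isHaarMeasure_two (F := ↥(maximalRealSubfield L)) (E := L) (c := IsCMField.complexConj L) ν
  have hcont : Continuous fun v : ↥(adelicUnipotent (↥(maximalRealSubfield L)) L (IsCMField.complexConj L) 2) => (quasiSplit (↥(maximalRealSubfield L)) L (IsCMField.complexConj L) 2).toAdelic (weylLongU ((IsCMField.complexConj L : L ≃ₐ[↥(maximalRealSubfield L)] L) : L →+* L) (rfl : (StdForm.antidiagonal 2).over L = (StdForm.antidiagonal 2).over L)) * ((v : (quasiSplit (↥(maximalRealSubfield L)) L (IsCMField.complexConj L) 2).Adelic) * g) := continuous_const.mul (continuous_subtype_val.mul continuous_const)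
  have hmeas : Measurable fun v : ↥(adelicUnipotent (↥(maximalRealSubfield L)) L (IsCMField.complexConj L) 2) => ((borelHeight ((quasiSplit (↥(maximalRealSubfield L)) L (IsCMField.complexConj L) 2).toAdelic (weylLongU ((IsCMField.complexConj L : L ≃ₐ[↥(maximalRealSubfield L)] L) : L →+* L) (rfl : (StdForm.antidiagonal 2).over L = (StdForm.antidiagonal 2).over L)) * ((v : (quasiSplit (↥(maximalRealSubfield L)) L (IsCMField.complexConj L) 2).Adelic) * g)) : ℝ≥0) : ℝ) := (NNReal.continuous_coe.comp (continuous_borelHeight.comp hcont)).measurable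
  have hcf : Measurable fun v : ↥(adelicUnipotent (↥(maximalRealSubfield L)) L (IsCMField.complexConj L) 2) => φ ((quasiSplit (↥(maximalRealSubfield L)) L (IsCMField.complexConj L) 2).toAdelic (weylLongU ((IsCMField.complexConj L : L ≃ₐ[↥(maximalRealSubfield L)] L) : L →+* L) (rfl : (StdForm.antidiagonal 2).over L = (StdForm.antidiagonal 2).over L)) * ((v : (quasiSplit (↥(maximalRealSubfield L)) L (IsCMField.complexConj L) 2).Adelic) * g)) := (hφc.comp hcont).measurable
  have h := differentiableOn_integral_mul_ofReal_cpow hcf hmeas (fun v => NNReal.coe_pos.2 (borelHeight_pos _)) (fun v => hφM _) (a := 1)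
    fun σ hσ => integrable_borelHeight_weylLongU_mul_rpow_cm_two L ν h𝓕N h𝓕c hσ g
  exact h.congr fun z _ => by simp only [flatSectionU_apply]

/-- **THE INTERTWINED COEFFICIENT `z ↦ φ̃_z(g) = (∫_{N(𝔸)} f_z^φ(w₀ v g) dν)·H(g)^{z−1}` IS HOLOMORPHIC ON `{1 < Re}`** for every `g`. [cite: MoeglinWaldspurger1995, II.1.7] -/
theorem differentiableOn_intertwinedCoeff_apply_cm_two (ν : Measure ↥(adelicUnipotent (↥(maximalRealSubfield L)) L (IsCMField.complexConj L) 2)) [ν.IsHaarMeasure]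
    {𝓕 : Set ↥(adelicUnipotent (↥(maximalRealSubfield L)) L (IsCMField.complexConj L) 2)} (h𝓕N : IsFundamentalDomain ↥(rationalUnipotent (↥(maximalRealSubfield L)) L (IsCMField.complexConj L) 2) 𝓕 ν) (h𝓕c : IsCompact (closure 𝓕))
    {φ : (quasiSplit (↥(maximalRealSubfield L)) L (IsCMField.complexConj L) 2).Adelic → ℂ} (hφc : Continuous φ) {Mφ : ℝ} (hφM : ∀ x, ‖φ x‖ ≤ Mφ) (g : (quasiSplit (↥(maximalRealSubfield L)) L (IsCMField.complexConj L) 2).Adelic) :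
    DifferentiableOn ℂ (fun z : ℂ => (fun g : (quasiSplit (↥(maximalRealSubfield L)) L (IsCMField.complexConj L) 2).Adelic => (∫ v : ↥(adelicUnipotent (↥(maximalRealSubfield L)) L (IsCMField.complexConj L) 2), flatSectionU φ z ((quasiSplit (↥(maximalRealSubfield L)) L (IsCMField.complexConj L) 2).toAdelic (weylLongU ((IsCMField.complexConj L : L ≃ₐ[↥(maximalRealSubfield L)] L) : L →+* L) (rfl : (StdForm.antidiagonal 2).over L = (StdForm.antidiagonal 2).over L)) * ((v : (quasiSplit (↥(maximalRealSubfield L)) L (IsCMField.complexConj L) 2).Adelic) * g)) ∂ν) * (((borelHeight g : ℝ) : ℂ) ^ (z - 1))) g) {z : ℂ | 1 < z.re} := by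
  have hH : (((borelHeight g : ℝ≥0) : ℝ) : ℂ) ≠ 0 := Complex.ofReal_ne_zero.2 (NNReal.coe_pos.2 (borelHeight_pos g)).ne'
  exact (differentiableOn_intertwiningIntegral_cm_two L ν h𝓕N h𝓕c hφc hφM g).mul fun z _ => ((differentiableAt_id.sub_const (1 : ℂ)).const_cpow (Or.inl hH)).differentiableWithinAt

/-- **HEAD — THE SCATTERING COORDINATES ARE HOLOMORPHIC ON `{1 < Re}`**: for continuous bounded `φ` and a linearly independent finite family `φ′_j` whose span contains every `φ̃_z`
(`1 < Re z`), there are `q_j` holomorphic on `{1 < Re}` with `Σ_j q_j(z) φ′_j = (ν𝓕)⁻¹·φ̃_z` — the letters `(q) (hq) (hqφ)` of ★ `chiEisenstein_meromorphic_exports_cm_two_of_letters`.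
[cite: BernsteinLapid2019, §4 p. 10, §7] [cite: MoeglinWaldspurger1995, II.1.7] -/
theorem exists_scatteringCoords_cm_two (ν : Measure ↥(adelicUnipotent (↥(maximalRealSubfield L)) L (IsCMField.complexConj L) 2)) [ν.IsHaarMeasure]
    {𝓕 : Set ↥(adelicUnipotent (↥(maximalRealSubfield L)) L (IsCMField.complexConj L) 2)} (h𝓕N : IsFundamentalDomain ↥(rationalUnipotent (↥(maximalRealSubfield L)) L (IsCMField.complexConj L) 2) 𝓕 ν) (h𝓕c : IsCompact (closure 𝓕))
    {φ : (quasiSplit (↥(maximalRealSubfield L)) L (IsCMField.complexConj L) 2).Adelic → ℂ} (hφc : Continuous φ) {Mφ : ℝ} (hφM : ∀ x, ‖φ x‖ ≤ Mφ)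
    {ι' : Type} [Fintype ι'] [DecidableEq ι'] {φ' : ι' → (quasiSplit (↥(maximalRealSubfield L)) L (IsCMField.complexConj L) 2).Adelic → ℂ} (hli : LinearIndependent ℂ φ')
    (hsp : ∀ z : ℂ, 1 < z.re → (fun g : (quasiSplit (↥(maximalRealSubfield L)) L (IsCMField.complexConj L) 2).Adelic => (∫ v : ↥(adelicUnipotent (↥(maximalRealSubfield L)) L (IsCMField.complexConj L) 2), flatSectionU φ z ((quasiSplit (↥(maximalRealSubfield L)) L (IsCMField.complexConj L) 2).toAdelic (weylLongU ((IsCMField.complexConj L : L ≃ₐ[↥(maximalRealSubfield L)] L) : L →+* L) (rfl : (StdForm.antidiagonal 2).over L = (StdForm.antidiagonal 2).over L)) * ((v : (quasiSplit (↥(maximalRealSubfield L)) L (IsCMField.complexConj L) 2).Adelic) * g)) ∂ν) * (((borelHeight g : ℝ) : ℂ) ^ (z - 1))) ∈ Submodule.span ℂ (Set.range φ')) :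
    ∃ q : ι' → ℂ → ℂ, (∀ j, DifferentiableOn ℂ (q j) {z : ℂ | 1 < z.re}) ∧ ∀ z : ℂ, 1 < z.re → (∑ j, q j z • φ' j) = ((((ν 𝓕).toReal⁻¹ : ℝ)) : ℂ) • (fun g : (quasiSplit (↥(maximalRealSubfield L)) L (IsCMField.complexConj L) 2).Adelic => (∫ v : ↥(adelicUnipotent (↥(maximalRealSubfield L)) L (IsCMField.complexConj L) 2), flatSectionU φ z ((quasiSplit (↥(maximalRealSubfield L)) L (IsCMField.complexConj L) 2).toAdelic (weylLongU ((IsCMField.complexConj L : L ≃ₐ[↥(maximalRealSubfield L)] L) : L →+* L) (rfl : (StdForm.antidiagonal 2).over L = (StdForm.antidiagonal 2).over L)) * ((v : (quasiSplit (↥(maximalRealSubfield L)) L (IsCMField.complexConj L) 2).Adelic) * g)) ∂ν) * (((borelHeight g : ℝ) : ℂ) ^ (z - 1))) :=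
  exists_coords_differentiableOn hli (S := {z : ℂ | 1 < z.re}) (v := fun z => ((((ν 𝓕).toReal⁻¹ : ℝ)) : ℂ) • (fun g : (quasiSplit (↥(maximalRealSubfield L)) L (IsCMField.complexConj L) 2).Adelic => (∫ v : ↥(adelicUnipotent (↥(maximalRealSubfield L)) L (IsCMField.complexConj L) 2), flatSectionU φ z ((quasiSplit (↥(maximalRealSubfield L)) L (IsCMField.complexConj L) 2).toAdelic (weylLongU ((IsCMField.complexConj L : L ≃ₐ[↥(maximalRealSubfield L)] L) : L →+* L) (rfl : (StdForm.antidiagonal 2).over L = (StdForm.antidiagonal 2).over L)) * ((v : (quasiSplit (↥(maximalRealSubfield L)) L (IsCMField.complexConj L) 2).Adelic) * g)) ∂ν) * (((borelHeight g : ℝ) : ℂ) ^ (z - 1)))) (fun z hz => Submodule.smul_mem _ _ (hsp z hz))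
    fun x => ((differentiableOn_intertwinedCoeff_apply_cm_two L ν h𝓕N h𝓕c hφc hφM x).const_mul ((((ν 𝓕).toReal⁻¹ : ℝ)) : ℂ)).congr fun z _ => by simp only [Pi.smul_apply, smul_eq_mul]

/-- **COROLLARY — FOR A BASIS OF `V(χʷ, K′, ω)`**: `K′ ≤ K_U`, `φ ∈ V(χ, K′, ω)` continuous bounded, `bV` a basis of `V(χʷ, K′, ω)`: the coordinates of `(ν𝓕)⁻¹·φ̃_z` in `bV` are holomorphic on
`{1 < Re}` (`φ̃_z ∈ V(χʷ, K′, ω)` by ★ `intertwinedCoeff_mem_chiSectionSpace`). [cite: BernsteinLapid2019, §4 p. 10, §7] [cite: MoeglinWaldspurger1995, II.1.7] -/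
theorem exists_scatteringCoords_of_basis_cm_two (ν : Measure ↥(adelicUnipotent (↥(maximalRealSubfield L)) L (IsCMField.complexConj L) 2)) [ν.IsHaarMeasure]
    {𝓕 : Set ↥(adelicUnipotent (↥(maximalRealSubfield L)) L (IsCMField.complexConj L) 2)} (h𝓕N : IsFundamentalDomain ↥(rationalUnipotent (↥(maximalRealSubfield L)) L (IsCMField.complexConj L) 2) 𝓕 ν) (h𝓕c : IsCompact (closure 𝓕))
    {χ : HeckeCharacter L} {K' : Subgroup (quasiSplit (↥(maximalRealSubfield L)) L (IsCMField.complexConj L) 2).Adelic} (hK' : K' ≤ ((standardMaximalCompactGL 2 L).comap (adelicVal (↥(maximalRealSubfield L)) L (IsCMField.complexConj L) 2 ((StdForm.antidiagonal 2).over L)) : Subgroup (quasiSplit (↥(maximalRealSubfield L)) L (IsCMField.complexConj L) 2).Adelic)) {ω : ↥K' → ℂ}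
    {φ : (quasiSplit (↥(maximalRealSubfield L)) L (IsCMField.complexConj L) 2).Adelic → ℂ} (hφV : φ ∈ chiSectionSpace χ K' ω) (hφc : Continuous φ) {Mφ : ℝ} (hφM : ∀ x, ‖φ x‖ ≤ Mφ)
    {ι' : Type} [Fintype ι'] [DecidableEq ι'] (bV : Module.Basis ι' ℂ ↥(chiSectionSpace (reflectChar (IsCMField.complexConj L) χ) K' ω)) :
    ∃ q : ι' → ℂ → ℂ, (∀ j, DifferentiableOn ℂ (q j) {z : ℂ | 1 < z.re}) ∧
      ∀ z : ℂ, 1 < z.re → (∑ j, q j z • ((bV j : ↥(chiSectionSpace (reflectChar (IsCMField.complexConj L) χ) K' ω)) : (quasiSplit (↥(maximalRealSubfield L)) L (IsCMField.complexConj L) 2).Adelic → ℂ)) = ((((ν 𝓕).toReal⁻¹ : ℝ)) : ℂ) • (fun g : (quasiSplit (↥(maximalRealSubfield L)) L (IsCMField.complexConj L) 2).Adelic => (∫ v : ↥(adelicUnipotent (↥(maximalRealSubfield L)) L (IsCMField.complexConj L) 2), flatSectionU φ z ((quasiSplit (↥(maximalRealSubfield L)) L (IsCMField.complexConj L) 2).toAdelic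 (weylLongU ((IsCMField.complexConj L : L ≃ₐ[↥(maximalRealSubfield L)] L) : L →+* L) (rfl : (StdForm.antidiagonal 2).over L = (StdForm.antidiagonal 2).over L)) * ((v : (quasiSplit (↥(maximalRealSubfield L)) L (IsCMField.complexConj L) 2).Adelic) * g)) ∂ν) * (((borelHeight g : ℝ) : ℂ) ^ (z - 1))) := by
  have hc : IsCMField.complexConj L * IsCMField.complexConj L = 1 := AlgEquiv.ext fun x => by rw [AlgEquiv.mul_apply, AlgEquiv.one_apply, IsCMField.complexConj_apply_apply]
  have hc1 : IsCMField.complexConj L ≠ 1 := IsCMField.complexConj_ne_one L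
  have hli : LinearIndependent ℂ (fun j => ((bV j : ↥(chiSectionSpace (reflectChar (IsCMField.complexConj L) χ) K' ω)) : (quasiSplit (↥(maximalRealSubfield L)) L (IsCMField.complexConj L) 2).Adelic → ℂ)) :=
    bV.linearIndependent.map' (Submodule.subtype _) (Submodule.ker_subtype _)
  refine exists_scatteringCoords_cm_two L ν h𝓕N h𝓕c hφc hφM hli fun z _ => ?_
  have hmem := intertwinedCoeff_mem_chiSectionSpace hc hc1 ν hK' hφV hφc.measurable z
  obtain ⟨w, hw⟩ : ∃ w : ↥(chiSectionSpace (reflectChar (IsCMField.complexConj L) χ) K' ω), (w : (quasiSplit (↥(maximalRealSubfield L)) L (IsCMField.complexConj L) 2).Adelic → ℂ) = (fun g : (quasiSplit (↥(maximalRealSubfield L)) L (IsCMField.complexConj L) 2).Adelic => (∫ v : ↥(adelicUnipotent (↥(maximalRealSubfield L)) L (IsCMField.complexConj L) 2), flatSectionU φ z ((quasiSplit (↥(maximalRealSubfield L)) L (IsCMField.complexConj L) 2).toAdelic (weylLongU ((IsCMField.complexConj L : L ≃ₐ[↥(maximalRealSubfield L)] L) : L →+* L) (rfl : (StdForm.antidiagonal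 2).over L = (StdForm.antidiagonal 2).over L)) * ((v : (quasiSplit (↥(maximalRealSubfield L)) L (IsCMField.complexConj L) 2).Adelic) * g)) ∂ν) * (((borelHeight g : ℝ) : ℂ) ^ (z - 1))) := ⟨⟨_, hmem⟩, rfl⟩
  rw [← hw, ← bV.sum_repr w, Submodule.coe_sum]
  refine Submodule.sum_mem _ fun j _ => ?_
  rw [Submodule.coe_smul]
  exact Submodule.smul_mem _ _ (Submodule.subset_span ⟨j, rfl⟩)

end CM

end Summit.HodgeConjecture.HodgeConjecture.Cruxes.H413.K2E1ChiScatteringCoordsHolomorphicCMTwo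

end
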